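import Literature.Geometry.Riemannian.MeanConvexLevelSetFlow
import HarnessLib

/-!
# Time translation of classical and weak set flows; restriction and concatenation of weak set flows

Topic `Literature/Geometry/Riemannian`. Bookkeeping for the tree's mean curvature flow vocabulary
(`IsClassicalMCF`, `IsWeakSetFlowIn` of `MeanConvexLevelSetFlow.lean`; general ambient manifold
`(M, g)`), used for the semigroup property of the level set flow
(`LevelSetFlowSemigroup.lean`): 

* `IsClassicalMCF.comp_add` — a classical mean curvature flow `(F, ν)` on `[a, b]`, read at times
  `r + s`, is a classical flow on `[a - s, b - s]` (`mfderiv_comp_add_apply_one`: the time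
  derivative of the translated family);
* `IsWeakSetFlowIn.comp_add` — weak set flows are invariant under time translation;
  `IsWeakSetFlowIn.mono_time` — and restrict to smaller time sets;
* `IsWeakSetFlowIn.concat` — **concatenation**: a weak set flow `K₁` on `[0, s]` followed after
  time `s` by a weak set flow `K₂` on `[s, ∞)` with `K₂ s ⊆ K₁ s` is a weak set flow on `[0, ∞)`
  (avoidance passes through the junction: a classical flow avoiding `K₁` up to time `s` avoids
  `K₂ s ⊆ K₁ s`, hence `K₂` afterwards).

Everything is PROVED; no definitions, no named facts.

## References

* B. White, *The size of the singular set in mean curvature flow of mean-convex sets*, J. Amer.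
  Math. Soc. 13 (2000), §2. [White2000]
* O. Hershkovits, B. White, Comm. Pure Appl. Math. 73 (2020), Appendix, Def. 19.
  [HershkovitsWhite2019]
-/

noncomputable section

open Bundle Set Function Metric Module Filter
open scoped Manifold ContDiff Topology

namespace Literature.Geometry.Riemannian

open Lorentzian Lorentzian.PseudoRiemannianMetric

universe u

variable {n : ℕ} {M : Type u} [TopologicalSpace M] [ChartedSpace (EuclideanSpace ℝ (Fin (n + 1))) M]
  [IsManifold (𝓡 (n + 1)) ∞ M]
  {g : PseudoRiemannianMetric (𝓡 (n + 1)) ∞ (EuclideanSpace ℝ (Fin (n + 1)))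
    (TangentSpace (𝓡 (n + 1)) : M → Type _)} [g.HasLeviCivita]

/-! ### Time translation of classical flows -/

section ClassicalShift

variable {N : Type*} [TopologicalSpace N] [ChartedSpace (EuclideanSpace ℝ (Fin n)) N]
  [IsManifold (𝓡 n) ∞ N] {F : ℝ → N → M} {ν : (t : ℝ) → NormalField (𝓡 (n + 1)) (F t)} {a b : ℝ}

omit [IsManifold (𝓡 (n + 1)) ∞ M] [IsManifold (𝓡 n) ∞ N] in
/-- The time derivative of a time-translated family: `∂ᵣ (F(r + s, y)) (t) = ∂ₜF(t + s, y)`.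
[folklore] -/
theorem mfderiv_comp_add_apply_one {F : ℝ → N → M} {U : Set ℝ} (hU : IsOpen U)
    (hF : ContMDiffOn (𝓘(ℝ, ℝ).prod (𝓡 n)) (𝓡 (n + 1)) ∞ (fun p : ℝ × N ↦ F p.1 p.2) (U ×ˢ univ))
    (s : ℝ) {t : ℝ} (ht : t + s ∈ U) (y : N) :
    mfderiv 𝓘(ℝ, ℝ) (𝓡 (n + 1)) (fun r ↦ F (r + s) y) t (1 : ℝ) =
      mfderiv 𝓘(ℝ, ℝ) (𝓡 (n + 1)) (fun r ↦ F r y) (t + s) (1 : ℝ) := by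
  have h1 : ContMDiffAt (𝓘(ℝ, ℝ).prod (𝓡 n)) (𝓡 (n + 1)) ∞ (fun p : ℝ × N ↦ F p.1 p.2) (t + s, y) :=
    hF.contMDiffAt ((hU.prod isOpen_univ).mem_nhds ⟨ht, mem_univ y⟩)
  have h2 : ContMDiffAt 𝓘(ℝ, ℝ) (𝓘(ℝ, ℝ).prod (𝓡 n)) ∞ (fun r : ℝ ↦ (r, y)) (t + s) :=
    contMDiffAt_id.prodMk contMDiffAt_const
  have hslice : MDifferentiableAt 𝓘(ℝ, ℝ) (𝓡 (n + 1)) (fun r ↦ F r y) (t + s) :=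
    (h1.comp (t + s) h2).mdifferentiableAt (by simp)
  have hshift : HasMFDerivAt 𝓘(ℝ, ℝ) 𝓘(ℝ, ℝ) (fun r : ℝ ↦ r + s) t (ContinuousLinearMap.id ℝ ℝ) :=
    ((hasFDerivAt_id t).add_const s).hasMFDerivAt
  have hcomp := hslice.hasMFDerivAt.comp t hshift
  have hc : HasMFDerivAt 𝓘(ℝ, ℝ) (𝓡 (n + 1)) (fun r ↦ F (r + s) y) t
      ((mfderiv 𝓘(ℝ, ℝ) (𝓡 (n + 1)) (fun r ↦ F r y) (t + s)).comp
        (ContinuousLinearMap.id ℝ ℝ)) := hcomp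
  rw [hc.mfderiv]
  rfl

/-- **Classical mean curvature flows are invariant under time translation**: if `(F, ν)` is a
classical flow on `[a, b]` then `r ↦ (F(r + s), ν(r + s))` is a classical flow on
`[a - s, b - s]`. [folklore] -/
theorem IsClassicalMCF.comp_add (h : IsClassicalMCF g F ν a b) (s : ℝ) :
    IsClassicalMCF g (fun r ↦ F (r + s)) (fun r ↦ ν (r + s)) (a - s) (b - s) := by
  obtain ⟨U, hU, hIU, hF⟩ := h.contMDiffOn
  have hmem : ∀ {r}, r ∈ Icc (a - s) (b - s) → r + s ∈ Icc a b := fun hr ↦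
    ⟨by linarith [hr.1], by linarith [hr.2]⟩
  have hU' : IsOpen ((fun r : ℝ ↦ r + s) ⁻¹' U) := hU.preimage (continuous_id.add continuous_const)
  refine
    { compactSpace := h.compactSpace
      contMDiffOn := ⟨(fun r : ℝ ↦ r + s) ⁻¹' U, hU', fun r hr ↦ hIU (hmem hr), ?_⟩
      isSpacelikeImmersion := fun r hr ↦ h.isSpacelikeImmersion (r + s) (hmem hr)
      injective := fun r hr ↦ h.injective (r + s) (hmem hr)
      isUnitNormal := fun r hr ↦ h.isUnitNormal (r + s) (hmem hr)
      contMDiff_normal := fun r hr ↦ h.contMDiff_normal (r + s) (hmem hr)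
      velocity_eq := fun r hr y ↦ ?_ }
  · -- joint smoothness of the shifted family
    have hsh : ContMDiff (𝓘(ℝ, ℝ).prod (𝓡 n)) (𝓘(ℝ, ℝ).prod (𝓡 n)) ∞
        (fun p : ℝ × N ↦ (p.1 + s, p.2)) :=
      (contMDiff_fst.add contMDiff_const).prodMk contMDiff_snd
    exact hF.comp hsh.contMDiffOn fun p hp ↦ ⟨hp.1, mem_univ _⟩
  · rw [mfderiv_comp_add_apply_one hU hF s (hIU (hmem hr)) y]
    exact h.velocity_eq (r + s) (hmem hr) y

end ClassicalShift

/-! ### Time translation, restriction and concatenation of weak set flows -/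

section WeakShift

/-- **Weak set flows are invariant under time translation**: `r ↦ K (r + s)` is a weak set flow on
`{r : r + s ∈ I}`. [cite: HershkovitsWhite2019, Appendix Def. 19] -/
theorem IsWeakSetFlowIn.comp_add {W : Set M} {I : Set ℝ} {K : ℝ → Set M}
    (h : IsWeakSetFlowIn g W I K) (s : ℝ) :
    IsWeakSetFlowIn g W ((fun r : ℝ ↦ r + s) ⁻¹' I) fun r ↦ K (r + s) := by
  obtain ⟨h1, ⟨C, hC, htr⟩, h3⟩ := h
  refine ⟨fun r hr ↦ h1 (r + s) hr, ⟨(fun p : M × ℝ ↦ (p.1, p.2 + s)) ⁻¹' C,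
    hC.preimage (continuous_fst.prodMk (continuous_snd.add continuous_const)), ?_⟩, ?_⟩
  · ext ⟨x, r⟩
    have key := Set.ext_iff.1 htr (x, r + s)
    simp only [mem_setOf_eq, mem_inter_iff, mem_prod, mem_preimage] at key ⊢
    tauto
  · intro a' b' hab' hI' N _ _ _ F ν hF hW hdis t ht
    have hflow := hF.comp_add (-s)
    have hmem : ∀ {r}, r ∈ Icc (a' - -s) (b' - -s) → r + -s ∈ Icc a' b' := fun hr ↦
      ⟨by linarith [hr.1], by linarith [hr.2]⟩
    have key := h3 (a := a' - -s) (b := b' - -s) (by linarith) (fun r hr ↦ by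
        have := hI' (hmem hr); simpa using this) N
      (fun r ↦ F (r + -s)) (fun r ↦ ν (r + -s)) hflow (fun r hr ↦ hW _ (hmem hr))
      (by simpa using hdis) (t + s) ⟨by linarith [ht.1], by linarith [ht.2]⟩
    simpa using key

/-- A weak set flow on `I` is a weak set flow on every `I' ⊆ I`. [folklore] -/
theorem IsWeakSetFlowIn.mono_time {W : Set M} {I I' : Set ℝ} {K : ℝ → Set M}
    (h : IsWeakSetFlowIn g W I K) (hI : I' ⊆ I) : IsWeakSetFlowIn g W I' K := by
  obtain ⟨h1, ⟨C, hC, htr⟩, h3⟩ := h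
  refine ⟨fun t ht ↦ h1 t (hI ht), ⟨C, hC, ?_⟩, fun a b hab hI' ↦ h3 hab (hI'.trans hI)⟩
  ext ⟨x, t⟩
  have key := Set.ext_iff.1 htr (x, t)
  simp only [mem_setOf_eq, mem_inter_iff, mem_prod] at key ⊢
  constructor
  · rintro ⟨ht, hx⟩
    exact ⟨(key.1 ⟨hI ht, hx⟩).1, (key.1 ⟨hI ht, hx⟩).2.1, ht⟩
  · rintro ⟨hc, hw, ht⟩
    exact ⟨ht, (key.2 ⟨hc, hw, hI ht⟩).2⟩

/-- **Concatenation of weak set flows.** If `K₁` is a weak set flow on `[0, s]`, `K₂` a weak set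
flow on `[s, ∞)` and `K₂ s ⊆ K₁ s`, then `K₁` followed by `K₂` (switching after time `s`) is a
weak set flow on `[0, ∞)`: the track is the union of the two closed tracks, and a classical flow
on `[a, b] ∋ s` avoiding it at time `a` avoids `K₁` up to time `s`, in particular `K₂ s`, hence
`K₂` afterwards. [cite: White2000, §2] -/
theorem IsWeakSetFlowIn.concat {W : Set M} {K₁ K₂ : ℝ → Set M} {s : ℝ} (hs : 0 ≤ s)
    (h₁ : IsWeakSetFlowIn g W (Icc 0 s) K₁) (h₂ : IsWeakSetFlowIn g W (Ici s) K₂)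
    (h12 : K₂ s ⊆ K₁ s) :
    IsWeakSetFlowIn g W (Ici 0) fun r ↦ if r ≤ s then K₁ r else K₂ r := by
  obtain ⟨h1W, ⟨C₁, hC₁, htr₁⟩, h1a⟩ := h₁
  obtain ⟨h2W, ⟨C₂, hC₂, htr₂⟩, h2a⟩ := h₂
  refine ⟨fun r hr ↦ ?_, ⟨C₁ ∩ (univ ×ˢ Icc 0 s) ∪ C₂ ∩ (univ ×ˢ Ici s),
    (hC₁.inter (isClosed_univ.prod isClosed_Icc)).union
      (hC₂.inter (isClosed_univ.prod isClosed_Ici)), ?_⟩, ?_⟩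
  · -- inside `W`
    by_cases hrs : r ≤ s
    · simp only [if_pos hrs]; exact h1W r ⟨hr, hrs⟩
    · simp only [if_neg hrs]; exact h2W r (le_of_lt (not_le.1 hrs))
  · -- the track
    ext ⟨x, r⟩
    have k₁ := Set.ext_iff.1 htr₁ (x, r)
    have k₂ := Set.ext_iff.1 htr₂ (x, r)
    simp only [mem_setOf_eq, mem_inter_iff, mem_prod, mem_Icc, mem_Ici, mem_univ, true_and,
      mem_union] at k₁ k₂ ⊢
    by_cases hrs : r ≤ s
    · simp only [if_pos hrs]
      constructor
      · rintro ⟨hr0, hx⟩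
        have := k₁.1 ⟨⟨hr0, hrs⟩, hx⟩
        exact ⟨Or.inl ⟨this.1, hr0, hrs⟩, this.2.1, hr0⟩
      · rintro ⟨hc | hc, hw, hr0⟩
        · exact ⟨hr0, (k₁.2 ⟨hc.1, hw, hr0, hrs⟩).2⟩
        · -- a point of `C₂` at a time `r ≤ s` with `r ≥ s`: `r = s`, and `K₂ s ⊆ K₁ s`
          have hrs' : r = s := le_antisymm hrs hc.2
          have hx2 : x ∈ K₂ r := (k₂.2 ⟨hc.1, hw, hc.2⟩).2
          subst hrs'
          exact ⟨hr0, h12 hx2⟩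
    · simp only [if_neg hrs]
      have hsr : s ≤ r := le_of_lt (not_le.1 hrs)
      constructor
      · rintro ⟨hr0, hx⟩
        have := k₂.1 ⟨hsr, hx⟩
        exact ⟨Or.inr ⟨this.1, hsr⟩, this.2.1, hr0⟩
      · rintro ⟨hc | hc, hw, hr0⟩
        · exact absurd hc.2.2 hrs
        · exact ⟨hr0, (k₂.2 ⟨hc.1, hw, hsr⟩).2⟩
  · -- avoidance
    intro a b hab hI N _ _ _ F ν hF hW hdis t ht
    have ha0 : 0 ≤ a := hI (left_mem_Icc.2 hab)
    by_cases hts : t ≤ s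
    · -- entirely within `K₁`
      have has : a ≤ s := ht.1.trans hts
      simp only [if_pos hts]
      simp only [if_pos has] at hdis
      exact h1a (a := a) (b := t) ht.1 (fun r hr ↦ ⟨ha0.trans hr.1, hr.2.trans hts⟩) N F ν
        (hF.mono (Icc_subset_Icc le_rfl ht.2)) (fun r hr ↦ hW r ⟨hr.1, hr.2.trans ht.2⟩) hdis t
        (right_mem_Icc.2 ht.1)
    · simp only [if_neg hts]
      have hst : s < t := not_le.1 hts
      by_cases has : a ≤ s
      · -- through the junction: `K₁` on `[a, s]`, then `K₂` on `[s, t]`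
        simp only [if_pos has] at hdis
        have hds : Disjoint (range (F s)) (K₁ s) :=
          h1a (a := a) (b := s) has (fun r hr ↦ ⟨ha0.trans hr.1, hr.2⟩) N F ν
            (hF.mono (Icc_subset_Icc le_rfl (hst.le.trans ht.2)))
            (fun r hr ↦ hW r ⟨hr.1, hr.2.trans (hst.le.trans ht.2)⟩) hdis s
            (right_mem_Icc.2 has)
        exact h2a (a := s) (b := t) hst.le (fun r hr ↦ hr.1) N F ν
          (hF.mono (Icc_subset_Icc has ht.2)) (fun r hr ↦ hW r ⟨has.trans hr.1, hr.2.trans ht.2⟩)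
          (hds.mono_right h12) t (right_mem_Icc.2 hst.le)
      · -- entirely within `K₂`
        have hsa : s < a := not_le.1 has
        simp only [if_neg has] at hdis
        exact h2a (a := a) (b := t) ht.1 (fun r hr ↦ hsa.le.trans hr.1) N F ν
          (hF.mono (Icc_subset_Icc le_rfl ht.2)) (fun r hr ↦ hW r ⟨hr.1, hr.2.trans ht.2⟩) hdis t
          (right_mem_Icc.2 ht.1)

end WeakShift

end Literature.Geometry.Riemannian

end
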